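import Summits.ABC.ABC.Theorems.DefiniteXiFreyModularityStubNineTransferExponent
import HarnessLib

/-!
# Crux `FreyModularity` (stmt-ABC-11340), line `Sketch`, stub `stub_nineTransfer`:
# at an additive place the inertia group fixes no point of prime order `ℓ ≥ 5`

Second support file for the stub `stub_nineTransfer` (Silverberg, CSS 1997, Prop. 7.1).  For an
elliptic curve `E/K` over a number field with **additive** reduction at a finite place `v`, a
prime `ℓ ≥ 5` with `v ∤ ℓ` and a prime `𝔓 ∣ v` of `\bar ℤ_K` with inertia group `I_𝔓 ≤ Γ_K`:
**every `I_𝔓`-fixed point `P ∈ E(K̄)` with `ℓ P = O` is `O`**, i.e. `E[ℓ]^{I_𝔓} = 0`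
(`stub_nineTransfer_torsion`).  Classical proof (Silverman, *AEC*, proof of Thm. VII.7.1 with
Cor. VII.6.2, Prop. VII.3.1 and VII.5.1(c); *ATAEC* Cor. IV.9.2(d)): `P ∈ E(K_v^nr)`;
`c P ∈ E₀(K_v^nr)` for the Kodaira–Néron exponent `c ∈ {1, 2, 3, 4}` of the first support file
(`stub_nineTransfer_exponent`); at an additive place `E₀/E₁ ≅ k̄⁺` has no `ℓ`-torsion (`ℓ` is a
unit of `k̄`) and neither has `E₁` (`|ℓ|_v = 1`), so `c P = O`; as `(c, ℓ) = 1`, `P = O`.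

The Galois-theoretic glue — transport of `E(K̄)` into the minimal model over `K̄_v` along a
`K`-embedding `ι : K̄ → K̄_v` (`pointsMapOfEmb`, `exists_addEquiv_localPoints_of_smul_eq`), local
inertia restricting into `I_{𝔓_{ι,𝔐}}` (`resGalOfEmb_mem_inertia_primeBelow`), the cusp
homomorphism `E₀ → k̄⁺` with kernel `E₁` (`exists_addMonoidHom_residueField_of_cusp`,
`ReducesToZero.eq_zero_of_zsmul_eq_zero`), and "every `𝔓 ∣ v` is a `𝔓_{ι,𝔐}`"
(`exists_smul_eq_of_mem_primesAbove_holds`, `primeBelow_comp`) — follows the tree's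
`codimFixed_inertia_rationalTate_eq_two_of_hasAdditiveReductionAt_of_kodairaNeron_primeBelow` /
`…_at` (`InertiaInvariantsKodairaNeronAdditiveProofs`) word for word.

## References

* [SilvermanAEC2009] J. H. Silverman, *The Arithmetic of Elliptic Curves*, 2nd ed. (2009),
  Prop. VII.3.1, Prop. VII.5.1(c), Cor. VII.6.2, proof of Thm. VII.7.1 (PDF pp. 171–179).
* [SilvermanATAEC1994] J. H. Silverman, *Advanced Topics in the Arithmetic of Elliptic Curves*,
  GTM 151 (1994), Cor. IV.9.2(d) (PDF p. 340), Table 4.1 (p. 365: `c_v ≤ 4` at additive `v`).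
* [SilverbergCSS1997] A. Silverberg, in: Cornell–Silverman–Stevens (eds.), *Modular Forms and
  Fermat's Last Theorem* (1997), Prop. 7.1.
-/

-- `Summit.<Summit>.<Problem>` is the mandated summit-side namespace (CONVENTIONS §2); for the
-- single-conjunct summit `ABC` the two coincide, so the duplicate `ABC.ABC` is deliberate.
set_option linter.dupNamespace false

noncomputable section

open scoped Classical NNReal NumberField Pointwise
open NumberField IsDedekindDomain Field

namespace Summit.ABC.ABC.Theorems

open Literature.NumberTheory.EllipticCurves Literature.NumberTheory.GaloisRepresentations
  IsDedekindDomain.HeightOneSpectrum WeierstrassCurve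

/-! ## An element killed by a prime `ℓ` and by some `0 < c < ℓ` is zero -/

/-- In an additive group, if `ℓ • P = 0` for a prime `ℓ` and `c • P = 0` for some `0 < c < ℓ`,
then `P = 0` (the order of `P` divides `gcd(c, ℓ) = 1`). [folklore] -/
theorem eq_zero_of_nsmul_eq_zero_of_lt {A : Type*} [AddCommGroup A] {ℓ c : ℕ} (hℓ : ℓ.Prime)
    (hc0 : c ≠ 0) (hcℓ : c < ℓ) {P : A} (hℓP : ℓ • P = 0) (hcP : c • P = 0) : P = 0 := by
  have hnd : ¬ ℓ ∣ c := Nat.not_dvd_of_pos_of_lt (Nat.pos_of_ne_zero hc0) hcℓ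
  have hcop : Nat.Coprime ℓ c := (Nat.Prime.coprime_iff_not_dvd hℓ).mpr hnd
  have h1 : addOrderOf P ∣ Nat.gcd ℓ c :=
    Nat.dvd_gcd (addOrderOf_dvd_of_nsmul_eq_zero hℓP) (addOrderOf_dvd_of_nsmul_eq_zero hcP)
  rw [hcop] at h1
  exact AddMonoid.addOrderOf_eq_one_iff.mp (Nat.dvd_one.mp h1)

/-! ## `E[ℓ]^{I} = 0` at an additive place, `ℓ ≥ 5` -/

variable {K : Type} [Field K] [NumberField K] {v : HeightOneSpectrum (𝓞 K)}

/-- **At an additive place the inertia group fixes no point of prime order `ℓ ≥ 5` — at the prime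
cut out by an embedding.**  For an elliptic curve `E/K` over a number field with additive
reduction at `v`, a prime `ℓ ≥ 5` with `v ∤ ℓ`, a `K`-embedding `ι : K̄ → K̄_v` and the prime `𝔐`
of `\bar 𝓞_v` above `𝓂_v`: a point `P ∈ E(K̄)` with `ℓ P = O` fixed by `I_{𝔓_{ι,𝔐}}` is `O`.
Proof: transport `P` into the minimal model `X` over `K̄_v` (`Φ ∘ ι_*`, equivariant, so the image
`Q` is `I_𝔐`-fixed); `c Q ∈ E₀` for the Kodaira–Néron exponent `c ∈ {1, …, 4}`
(`stub_nineTransfer_exponent`); the cusp homomorphism `E₀ → k̄⁺`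
(`exists_addMonoidHom_residueField_of_cusp`) kills `c Q` because `ℓ` does and `ℓ ∈ k̄^×`, so `c Q`
reduces to `O`, hence `c Q = O` (`ReducesToZero.eq_zero_of_zsmul_eq_zero`, `|ℓ|_v = 1`); so
`c P = O` and `P = O` as `(c, ℓ) = 1`.  Silverman, *AEC*, proof of Thm. VII.7.1 (PDF p. 179) with
*ATAEC* Cor. IV.9.2(d).
[cite: SilvermanAEC2009, proof of Thm. VII.7.1 with Cor. VII.6.2, Prop. VII.3.1, VII.5.1(c) (PDF pp. 171–179)] -/
theorem smul_eq_zero_of_hasAdditiveReductionAt_primeBelow (W : WeierstrassCurve K) [W.IsElliptic]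
    {ℓ : ℕ} (hℓp : ℓ.Prime) (hℓ4 : 4 < ℓ) (hℓ : (ℓ : 𝓞 K) ∉ v.asIdeal)
    (hadd : W.HasAdditiveReductionAt v)
    (ι : AlgebraicClosure K →ₐ[K] AlgebraicClosure (v.adicCompletion K))
    {𝔐 : Ideal v.localAbsIntegers} (h𝔐 : 𝔐 ∈ v.localPrimesAbove) {P : geomPoints W}
    (hP : ℓ • P = 0)
    (hfix : ∀ σ ∈ (v.primeBelow ι 𝔐).inertia (absoluteGaloisGroup K), σ • P = P) : P = 0 := by
  obtain ⟨w, hw⟩ := v.exists_spectralValuation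
  have hv0 : w.Integers w.integer := Valuation.integer.integers w
  -- the minimal model `X` at `v` and a `w`-integral model `W₀`
  haveI : (W.localMinimalModel v).IsElliptic := W.isElliptic_localMinimalModel v
  have hint : ((W.localMinimalModel v).baseChange (AlgebraicClosure (v.adicCompletion K))).IsIntegral
      w.integer := by
    have := isIntegral_spectralValuation_baseChange hw
      ((W.localMinimalModel v).integralModel (v.adicCompletionIntegers K))
    rwa [show ((W.localMinimalModel v).integralModel (v.adicCompletionIntegers K)).map
        (algebraMap (v.adicCompletionIntegers K) (v.adicCompletion K)) = W.localMinimalModel v from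
      baseChange_integralModel_eq (v.adicCompletionIntegers K) (W.localMinimalModel v)] at this
  obtain ⟨W₀, hW₀⟩ := hint.integral
  -- the reduction of `W₀` is a cusp
  have hcoef : ∀ {a : v.adicCompletionIntegers K} (b : w.integer),
      algebraMap w.integer (AlgebraicClosure (v.adicCompletion K)) b =
        algebraMap (v.adicCompletion K) (AlgebraicClosure (v.adicCompletion K))
          (algebraMap (v.adicCompletionIntegers K) (v.adicCompletion K) a) →
      IsDedekindDomain.HeightOneSpectrum.valuation (v.adicCompletion K)
          (IsDiscreteValuationRing.maximalIdeal (v.adicCompletionIntegers K))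
          (algebraMap (v.adicCompletionIntegers K) (v.adicCompletion K) a) < 1 →
      IsLocalRing.residue w.integer b = 0 := by
    intro a b hab hlt
    have hmem : a ∈ IsLocalRing.maximalIdeal (v.adicCompletionIntegers K) :=
      (IsDedekindDomain.HeightOneSpectrum.valuation_lt_one_iff_mem _ a).mp hlt
    rw [← v_algebraMap_lt_one_iff hv0, hab]
    exact spectralValuation_algebraMap_lt_one_of_mem_maximalIdeal hw h𝔐 hmem
  have hΔ : IsLocalRing.residue w.integer W₀.Δ = 0 := by
    refine hcoef (a := ((W.localMinimalModel v).integralModel (v.adicCompletionIntegers K)).Δ)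
      W₀.Δ ?_ ?_
    · rw [integralModel_Δ_eq, ← map_Δ, ← map_Δ]
      change (W₀.baseChange (AlgebraicClosure (v.adicCompletion K))).Δ =
        ((W.localMinimalModel v).baseChange (AlgebraicClosure (v.adicCompletion K))).Δ
      rw [hW₀]
    · rw [integralModel_Δ_eq]; exact hadd.badReduction
  have hc₄ : IsLocalRing.residue w.integer W₀.c₄ = 0 := by
    refine hcoef (a := ((W.localMinimalModel v).integralModel (v.adicCompletionIntegers K)).c₄)
      W₀.c₄ ?_ ?_
    · rw [integralModel_c₄_eq, ← map_c₄, ← map_c₄]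
      change (W₀.baseChange (AlgebraicClosure (v.adicCompletion K))).c₄ =
        ((W.localMinimalModel v).baseChange (AlgebraicClosure (v.adicCompletion K))).c₄
      rw [hW₀]
    · rw [integralModel_c₄_eq]; exact hadd.additiveReduction
  obtain ⟨rc, hrc⟩ := W₀.exists_addMonoidHom_residueField_of_cusp hv0 hΔ hc₄
  -- transport of `E(K̄)` to `X(K̄_v)`, equivariantly, and the exponent of Kodaira–Néron
  obtain ⟨C, hC⟩ := W.exists_variableChange_smul_eq_localMinimalModel v
  obtain ⟨Φ, hΦ⟩ := W.exists_addEquiv_localPoints_of_smul_eq v hC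
  obtain ⟨c, hc0, hc4, hcE₀⟩ := stub_nineTransfer_exponent W hadd hw h𝔐
  -- the image `Q` of `P` in `X(K̄_v)` is fixed by `I_𝔐`
  set Q := Φ (pointsMapOfEmb W ι P) with hQdef
  have hQfix : ∀ σ ∈ 𝔐.inertia (absoluteGaloisGroup (v.adicCompletion K)),
      Affine.Point.map ((absoluteGaloisGroup.toAlgEquiv _ σ :
          AlgebraicClosure (v.adicCompletion K) ≃ₐ[v.adicCompletion K]
            AlgebraicClosure (v.adicCompletion K)) :
          AlgebraicClosure (v.adicCompletion K) →ₐ[v.adicCompletion K]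
            AlgebraicClosure (v.adicCompletion K)) Q = Q := by
    intro σ hσ
    rw [hQdef, ← hΦ σ, ← pointsMapOfEmb_smul]
    congr 2
    exact hfix _ (resGalOfEmb_mem_inertia_primeBelow v ι 𝔐 hσ)
  -- `c • Q ∈ E₀` on the `𝒪_w`-model `W₀`
  set R := Affine.Point.congrEquiv hW₀ (c • Q) with hRdef
  have hR : W₀.HasNonsingularReduction R :=
    (reducesToNonsingular_iff_hasNonsingularReduction W₀ _).mp
      ((reducesToNonsingular_congrEquiv_iff _ hW₀ _).mpr (hcE₀ Q hQfix))
  -- `ℓ • R = 0`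
  have hℓQ : ℓ • Q = 0 := by
    rw [hQdef, ← map_nsmul, ← map_nsmul, hP, map_zero, map_zero]
  have hℓcQ : ℓ • (c • Q) = 0 := by
    rw [smul_smul, mul_comm, ← smul_smul, hℓQ, nsmul_zero]
  have hℓR' : ℓ • R = 0 := by
    rw [hRdef, ← map_nsmul, hℓcQ, map_zero]
  have hℓR : (ℓ : ℤ) • R = 0 := by
    rw [natCast_zsmul]; exact hℓR'
  -- `ℓ` is a `v`-unit: `|ℓ|_v = 1` and `ℓ ≠ 0` in `k̄`
  have hℓw : w ((ℓ : ℤ) : AlgebraicClosure (v.adicCompletion K)) = 1 :=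
    spectralValuation_intCast_eq_one hw (n := (ℓ : ℤ)) (by simpa using hℓ)
  have hℓk : ((ℓ : ℕ) : AlgebraicClosure (IsLocalRing.ResidueField w.integer)) ≠ 0 := by
    have hℓw' : w (algebraMap w.integer (AlgebraicClosure (v.adicCompletion K)) (ℓ : w.integer)) =
        1 := by
      rw [map_natCast]; exact_mod_cast hℓw
    have h1 : IsLocalRing.residue w.integer (ℓ : w.integer) ≠ 0 :=
      (v_algebraMap_eq_one_iff hv0 _).mp hℓw'
    have := (_root_.map_ne_zero (algebraMap (IsLocalRing.ResidueField w.integer)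
      (AlgebraicClosure (IsLocalRing.ResidueField w.integer)))).mpr h1
    simpa using this
  -- the reduction of `c • Q` in `k̄⁺` is killed by `ℓ`, hence vanishes: `c • Q` reduces to `O`
  have hr0 : rc ⟨R, hR⟩ = 0 := by
    have hsub : ℓ • (⟨R, hR⟩ : W₀.nonsingularReductionSubgroup hv0) = 0 :=
      Subtype.ext (by rw [AddSubgroup.coe_nsmul, AddSubgroup.coe_zero]; exact hℓR')
    have h1 : (ℓ : AlgebraicClosure (IsLocalRing.ResidueField w.integer)) * rc ⟨R, hR⟩ = 0 := by
      rw [← nsmul_eq_mul, ← map_nsmul, hsub, map_zero]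
    exact (mul_eq_zero.mp h1).resolve_left hℓk
  have h0 : W₀.ReducesToZero R := (hrc ⟨R, hR⟩).mp hr0
  -- so `c • Q = O` (`E₁` has no `ℓ`-torsion), `c • P = O`, and `P = O`
  have hR0 : R = 0 := h0.eq_zero_of_zsmul_eq_zero W₀ hℓw hℓR
  have hcQ : c • Q = 0 := by
    apply (Affine.Point.congrEquiv hW₀).injective
    rw [← hRdef, hR0, map_zero]
  have hcP : c • P = 0 := by
    apply pointsMapOfEmb_injective W ι
    apply Φ.injective
    rw [map_nsmul, map_nsmul, ← hQdef, hcQ, map_zero, map_zero]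
  exact eq_zero_of_nsmul_eq_zero_of_lt hℓp hc0 (lt_of_le_of_lt hc4 hℓ4) hP hcP

/-- **At an additive place the inertia group fixes no point of prime order `ℓ ≥ 5` — at every
prime `𝔓 ∣ v`** (every such prime is cut out by an embedding: `Γ_K` is transitive on the primes
above `v`, `exists_smul_eq_of_mem_primesAbove_holds`, and `𝔓_{ι∘τ,𝔐} = τ⁻¹ • 𝔓_{ι,𝔐}`,
`primeBelow_comp`; as in the tree's `…_of_kodairaNeron_at`).
[cite: SilvermanAEC2009, proof of Thm. VII.7.1 with Cor. VII.6.2, Prop. VII.3.1, VII.5.1(c) (PDF pp. 171–179)] -/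
theorem smul_eq_zero_of_hasAdditiveReductionAt_of_mem_primesAbove (W : WeierstrassCurve K)
    [W.IsElliptic] {ℓ : ℕ} (hℓp : ℓ.Prime) (hℓ4 : 4 < ℓ) (hℓ : (ℓ : 𝓞 K) ∉ v.asIdeal)
    (hadd : W.HasAdditiveReductionAt v) {𝔓 : Ideal (absIntegers (𝓞 K) K)}
    (h𝔓 : 𝔓 ∈ v.primesAbove) {P : geomPoints W} (hP : ℓ • P = 0)
    (hfix : ∀ σ ∈ 𝔓.inertia (absoluteGaloisGroup K), σ • P = P) : P = 0 := by
  obtain ⟨𝔐, h𝔐⟩ := v.localPrimesAbove_nonempty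
  obtain ⟨g, hg⟩ := HeightOneSpectrum.exists_smul_eq_of_mem_primesAbove_holds
    (HeightOneSpectrum.primeBelow_mem_primesAbove
      (ι := closureEmb (K := K) (v.adicCompletion K)) h𝔐) h𝔓
  have h1 : 𝔓 = v.primeBelow ((closureEmb (K := K) (v.adicCompletion K)).comp
      ((show AlgebraicClosure K ≃ₐ[K] AlgebraicClosure K from g⁻¹) :
        AlgebraicClosure K →ₐ[K] AlgebraicClosure K)) 𝔐 := by
    rw [HeightOneSpectrum.primeBelow_comp, ← hg]
    exact congrArg (· • _) (inv_inv g).symm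
  rw [h1] at hfix
  exact smul_eq_zero_of_hasAdditiveReductionAt_primeBelow W hℓp hℓ4 hℓ hadd _ h𝔐 hP hfix

/-! ## The registered helper stub -/

/-- **Registered helper stub toward `stub_nineTransfer`: `E[ℓ]^{I_𝔓} = 0` at an additive place,
`ℓ ≥ 5`.**  For an elliptic curve `E/K` over a number field, a prime `ℓ ≥ 5`, a finite place
`v ∤ ℓ` of additive reduction and a prime `𝔓 ∣ v` of `\bar ℤ_K`: an `ℓ`-torsion point of `E(K̄)`
fixed by the inertia group `I_𝔓` is `O` (`E(K_v^nr)[ℓ] ↪ E(K_v^nr)/E₀(K_v^nr)`, of order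
`c_v ≤ 4`).  This is the local fact behind the transfer of semistability at `3` along
`E[5] ≅ E'[5]` (Silverberg, CSS 1997, Prop. 7.1): a curve semistable at `3` has
`E[5]^{I_3} ≠ 0`, an additive one has `E'[5]^{I_3} = 0`.
[cite: SilvermanAEC2009, proof of Thm. VII.7.1 with Cor. VII.6.2, Prop. VII.3.1, VII.5.1(c) (PDF pp. 171–179)] -/
theorem stub_nineTransfer_torsion :
    ∀ {K : Type} [Field K] [NumberField K] (W : WeierstrassCurve K) [W.IsElliptic] {ℓ : ℕ},
      ℓ.Prime → 4 < ℓ → ∀ {v : HeightOneSpectrum (𝓞 K)}, (ℓ : 𝓞 K) ∉ v.asIdeal →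
      W.HasAdditiveReductionAt v → ∀ {𝔓 : Ideal (absIntegers (𝓞 K) K)}, 𝔓 ∈ v.primesAbove →
      ∀ P : geomPoints W, ℓ • P = 0 →
        (∀ σ ∈ 𝔓.inertia (absoluteGaloisGroup K), σ • P = P) → P = 0 :=
  fun W _ _ hℓp hℓ4 _ hℓ hadd _ h𝔓 _ hP hfix ↦
    smul_eq_zero_of_hasAdditiveReductionAt_of_mem_primesAbove W hℓp hℓ4 hℓ hadd h𝔓 hP hfix

end Summit.ABC.ABC.Theorems

end
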